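import Summits.BirchSwinnertonDyer.BirchSwinnertonDyer.Theorems.KatoDescentPotSupersingularUnramifiedLocalConditionSelfDual
import Summits.BirchSwinnertonDyer.Rank1Residual.GaloisImage.KummerSelfDualCount
import Summits.BirchSwinnertonDyer.Rank1Residual.GaloisImage.SelmerPairCounting
import Summits.BirchSwinnertonDyer.Rank1Residual.GaloisImage.SelmerGroupFinite
import Summits.BirchSwinnertonDyer.Rank1Residual.GaloisImage.LocalEulerPoincareCharacteristicHolds
import HarnessLib

/-!
# Kato's (14.9.3) / Prop. 14.16 (2) AT FINITE LEVEL `p^k`: the Poitou–Tate COUNT of Kato's structures on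
# `E[n]` over a number field — `#H¹_rel(K, E[n]) = #H¹_str(K, E[n]) · ∏_{v ∈ P} #(E(K_v)/n)`, where the local
# conditions are UNRAMIFIED at every finite `v ∉ P` (bad primes included), `0` resp. everything at `v ∈ P ⊇ {v ∣ n}`
# (route `KatoDescentPotSupersingular` / `…Tame…`, crux M = stmt-BirchSwinnertonDyer-19196; route-free helper)

Seat `bsd-potss-rkm` g17 (prover; cell `bsd-potss`), item stmt-BirchSwinnertonDyer-19196 `ReducibleKatoMember`
(`--supports … --as helper`; closes nothing).  HONEST FRAMING: BSD is not proved by any of this; nothing is booked;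
theorems only (no definition, no named fact).  CONDITIONAL on a Poitou–Tate family `inv` (`IsPerfect`,
`SumLocalTermEqZero`, `SelmerComplement` — the content of the named fact `poitouTate_selmerStructure_duality K`;
for the canonical family the first two are tree theorems) and on Weil-pairing data `e` on `E[n]` (the six
properties of `WeierstrassCurve.exists_weilPairing`, a tree theorem `…_holds`), both taken as hypotheses exactly
as in n1011's `GaloisImage.KummerSelfDualCount`.

## What (K. Kato, Astérisque 295 (2004) §14.8–14.9, 14.16; this is brick (i) of FINDING-19196-rkm-g16 §NEXT)

Kato's groups `H¹(O_K[1/p], T)`, `S(K, T) = Ker(H¹(O_K[1/p], T ⊗ ℚ/ℤ) → ⊕_{v∣p} H¹(K_v, T ⊗ ℚ/ℤ)/H¹_f)`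
(14.8, p. 238) and the kernel `Ker(H²(O_K[1/p], T) → H²(K ⊗ ℚ_p, T))` of (14.9.3) (p. 240) — for `T = T_pE` the
Pontryagin dual of `{c ∈ H¹(O_K[1/p], E[p^∞]) | loc_v c = 0 ∀ v ∣ p}` — are Selmer groups whose local condition
at every finite `v ∤ p`, the BAD primes included, is the UNRAMIFIED one (§8.2: cohomology of `j_*`; Lemma 8.5).
At the finite level `E[n]`, `n = p^k` ODD, write for a finite set `P ⊇ {v ∣ n}` of finite places

  `𝓢` ("strict"):  `𝓢_v = 0` (`v ∈ P`), `𝓢_v = H¹_ur(K_v, E[n])` (finite `v ∉ P`);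
  `ℛ` ("relaxed"): `ℛ_v = H¹(K_v, E[n])` (`v ∈ P`), `ℛ_v = H¹_ur(K_v, E[n])` (finite `v ∉ P`)

(anything at the infinite places, where `H¹ = 0` for odd `n`).  THIS FILE PROVES, for every such pair of
Selmer structures (hypothesis form, no definition):

  **`natCard_selmerGroup_relaxed_eq`: `#H¹_ℛ(K, E[n]) = #H¹_𝓢(K, E[n]) · ∏_{v ∈ P} #𝓚_v`**,

`𝓚_v = Im(E(K_v)/n → H¹(K_v, E[n]))` the local Kummer condition (`#𝓚_v = #E(K_v)/nE(K_v)`).  This is the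
counting content of Kato's (14.9.3) between the terms `H¹(O_K[1/p], T)` and `Ker(H² → H²_p)` at the finite
level `T/p^k` (and of (14.16.2)–(14.16.3), p. 245): in the limit `k → ∞` the left side is governed by
`H¹(O_K[1/p], T_pE)` (inverse limit) and the right side by `Ker(H²(O_K[1/p], T_pE) → H²(K ⊗ ℚ_p, T_pE))^∨`
(direct limit) and `∏_{v∣p} #E(K_v) ⊗ ℚ_p/ℤ_p`-data; the passage to the limit is NOT done here.

## Proof

Insert Kato's structure `𝓚'` (`𝓚_v` at `v ∈ P`, unramified off `P`): `𝓢 ≤ 𝓚'`.  The tree's pair-counting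
form of Poitou–Tate (n1011, `GaloisImage.card_selmerGroup_pair`, Howard Thm. 2.1.11 / Milne I 4.10 / DDT 2.19)
gives `#H¹_{𝓚'}·#H¹_{𝓢^*}(E[n]^D)·∏_{T} #𝓢_v = #H¹_𝓢·#H¹_{𝓚'^*}(E[n]^D)·∏_{T} #𝓚'_v` over a finite set
`T ⊇ P` containing the ramification.  The DUAL structures on `E[n]^D = Hom(E[n], μₙ)` are identified through
the Weil pairing `θ : E[n] ⥲ E[n]^D`: `(0)^* = ⊤`; `𝓚_v^* = θ(𝓚_v)` at every finite place (Tate local duality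
for `E`, n1011 `dualTransported_kummerSelmerStructure_inr`, from the local Euler–Poincaré characteristic — a
tree THEOREM, `localEulerPoincareCharacteristic_holds` — and the injectivity of `inv_v`); and at the finite
`v ∉ P` (so `v ∤ n`), where `E[n]` may be RAMIFIED, **`(H¹_ur)^* = H¹_ur(E[n]^D) = θ(H¹_ur)`** by the companion
file `…UnramifiedLocalConditionSelfDual` (Milne I 2.6 without the unramified hypothesis).  Hence
`#H¹_{𝓢^*}(E[n]^D) = #H¹_ℛ(E[n])` and `#H¹_{𝓚'^*}(E[n]^D) = #H¹_{𝓚'}(E[n])` (injections both ways), and the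
positive factor `#H¹_{𝓚'}·∏_{T∖P} #H¹_ur` cancels.

References: K. Kato, Astérisque 295 (2004), §8.2, Lemma 8.5, 14.8, (14.9.3)–(14.9.4), Prop. 14.16 [Kato2004Asterisque];
J. S. Milne, *ADT* (2006) I Thm. 2.6, Cor. 3.4, Thm. 4.10 [MilneADT2006]; B. Howard, Compos. Math. 140 (2004) Thm. 2.1.11
[Howard2004HeegnerKolyvagin]; H. Darmon, F. Diamond, R. Taylor (1997) Thm. 2.19.
-/

-- the summit and its single problem are both named `BirchSwinnertonDyer` (registry layout D-0017)
set_option linter.dupNamespace false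
set_option autoImplicit false

noncomputable section

open scoped Classical ContRepresentation NumberField
open Function Field NumberField IsDedekindDomain WeierstrassCurve
open Literature.NumberTheory.EllipticCurves Literature.NumberTheory.GaloisRepresentations
  Literature.NumberTheory.GaloisRepresentations.DiscreteGaloisModule Literature.NumberTheory.GaloisCohomology
open Summit.BirchSwinnertonDyer.Rank1Residual.X11b.Levels Summit.BirchSwinnertonDyer.Rank1Residual.X11b.LocBridge
open Summit.BirchSwinnertonDyer.Rank1Residual.GaloisImage

universe u

namespace Summit.BirchSwinnertonDyer.BirchSwinnertonDyer.Theorems.KatoFiniteLevelCount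

variable {K : Type u} [Field K] [NumberField K] (W : WeierstrassCurve K) (n : ℕ) [NeZero n]
  [W.IsElliptic]
-- `E[n]` is finite (`finite_geomTorsion_of_neZero W n`); carried as an instance binder rather than a local
-- instance attribute, so that consumers supply `haveI := finite_geomTorsion_of_neZero W n`.
variable [Finite (geomTorsion W n)]
variable (e : geomTorsion W n → geomTorsion W n → AlgebraicClosure K)
  (hμ : ∀ S T, e S T ^ n = 1)
  (hadd₁ : ∀ S₁ S₂ T, e (S₁ + S₂) T = e S₁ T * e S₂ T)
  (hadd₂ : ∀ S T₁ T₂, e S (T₁ + T₂) = e S T₁ * e S T₂)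
  (hgal : ∀ (σ : absoluteGaloisGroup K) (S T : geomTorsion W n), σ • e S T = e (σ • S) (σ • T))

/-! ## §1 Transport of the dual structures through the Weil pairing -/

/-- **`θ_*` carries `H¹_𝓐(K, E[n])` into `H¹_{𝓑^*}(K, E[n]^D)` and `θ⁻¹_*` carries it back, whenever at every
FINITE place `θ⁻¹(𝓑_v^*) = 𝓐_v`** (`inv.dualTransported 𝓑 θ (inr v) = 𝓐 (inr v)`) and `n` is odd (so both
`H¹(K_w, ·)` vanish at the infinite places): then `#H¹_𝓐(K, E[n]) = #H¹_{𝓑^*}(K, E[n]^D)` when the former is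
finite.  The mechanism of n1011's `natCard_selmerGroup_kummer_eq_dual` (the case `𝓐 = 𝓑 = 𝓚`), stated for an
arbitrary pair. [folklore] -/
theorem natCard_selmerGroup_eq_natCard_dualSelmerGroup_of_dualTransported
    (hnondeg : ∀ T, (∀ S, e S T = 1) → T = 0) (hodd : Odd n)
    (inv : LocalInvariants K n) (𝓐 𝓑 : SelmerStructure (W.torsionGaloisModule n))
    (hAB : ∀ v : HeightOneSpectrum (𝓞 K),
      inv.dualTransported 𝓑 (weilDualIntertwining W n e hμ hadd₁ hadd₂ hgal) (Sum.inr v) = 𝓐 (Sum.inr v))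
    [Finite 𝓐.selmerGroup] :
    Nat.card 𝓐.selmerGroup =
      Nat.card (inv.dualSelmerStructure (W.torsionGaloisModule n) 𝓑).selmerGroup := by
  -- `θ_*` maps `H¹_𝓐` into `H¹_{𝓑^*}`
  have hto : ∀ {x : galoisCohomology (W.torsionGaloisModule n) 1}, x ∈ 𝓐.selmerGroup →
      galoisCohomology.map (weilDualIntertwining W n e hμ hadd₁ hadd₂ hgal) 1 x ∈
        (inv.dualSelmerStructure (W.torsionGaloisModule n) 𝓑).selmerGroup := by
    intro x hx
    rw [SelmerStructure.mem_selmerGroup_iff] at hx ⊢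
    intro v
    rw [localization_map_one']
    rcases v with w | v
    · set z := galoisCohomology.map ((weilDualIntertwining W n e hμ hadd₁ hadd₂ hgal).restrictField
        (Place.Completion (Sum.inl w : Place K))) 1 (galoisCohomology.localization _ (Sum.inl w) 1 x)
      have h0 : z = 0 := galoisCohomology_one_tateDual_torsion_eq_zero_infinitePlace_of_odd W n hodd w z
      rw [h0]; exact zero_mem _
    · have h := hx (Sum.inr v)
      rw [← hAB v, LocalInvariants.mem_dualTransported_iff] at h
      exact h
  -- `θ⁻¹_*` maps `H¹_{𝓑^*}` into `H¹_𝓐`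
  have hfrom : ∀ {y : galoisCohomology ((W.torsionGaloisModule n).tateDual n) 1},
      y ∈ (inv.dualSelmerStructure (W.torsionGaloisModule n) 𝓑).selmerGroup →
      galoisCohomology.map (weilDualInv W n e hμ hadd₁ hadd₂ hgal hnondeg) 1 y ∈ 𝓐.selmerGroup := by
    intro y hy
    rw [SelmerStructure.mem_selmerGroup_iff] at hy ⊢
    intro v
    rw [localization_map_one']
    rcases v with w | v
    · set z := galoisCohomology.map ((weilDualInv W n e hμ hadd₁ hadd₂ hgal hnondeg).restrictField
        (Place.Completion (Sum.inl w : Place K))) 1 (galoisCohomology.localization _ (Sum.inl w) 1 y)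
      have h0 : z = 0 :=
        galoisCohomology_one_torsion_eq_zero_infinitePlace_of_odd W w ((Int.odd_coe_nat n).mpr hodd) z
      rw [h0]; exact zero_mem _
    · rw [← hAB v, LocalInvariants.mem_dualTransported_iff]
      change galoisCohomology.map ((weilDualIntertwining W n e hμ hadd₁ hadd₂ hgal).restrictField
          (Place.Completion (Sum.inr v))) 1 (galoisCohomology.map ((weilDualInv W n e hμ hadd₁ hadd₂ hgal
            hnondeg).restrictField (Place.Completion (Sum.inr v))) 1 _) ∈ _
      rw [map_weilDual_map_weilDualInv_restrictField]
      exact hy (Sum.inr v)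
  let f : 𝓐.selmerGroup → (inv.dualSelmerStructure (W.torsionGaloisModule n) 𝓑).selmerGroup :=
    fun x => ⟨_, hto x.2⟩
  let g : (inv.dualSelmerStructure (W.torsionGaloisModule n) 𝓑).selmerGroup → 𝓐.selmerGroup :=
    fun y => ⟨_, hfrom y.2⟩
  have hf : Injective f := fun x x' h => Subtype.ext
    (map_injective_of_comp_eq _ _ (weilDualInv_weilDualIntertwining W n e hμ hadd₁ hadd₂ hgal hnondeg)
      (congrArg Subtype.val h))
  have hg : Injective g := fun y y' h => Subtype.ext
    (map_injective_of_comp_eq _ _ (weilDualIntertwining_weilDualInv W n e hμ hadd₁ hadd₂ hgal hnondeg)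
      (congrArg Subtype.val h))
  haveI : Finite (inv.dualSelmerStructure (W.torsionGaloisModule n) 𝓑).selmerGroup := Finite.of_injective g hg
  exact le_antisymm (Nat.card_le_card_of_injective f hf) (Nat.card_le_card_of_injective g hg)

/-- **The transported dual of the UNRAMIFIED condition is the unramified condition, `θ⁻¹((H¹_ur)^*) = H¹_ur`, at
every finite `v ∤ n` — for the possibly RAMIFIED module `E[n]`** (perfect family, prime-power `n`): the companion
file's `UnramifiedSelfDual.dualLocalCondition_unramifiedSubgroup` (`(H¹_ur(K_v, E[n]))^* = H¹_ur(K_v, E[n]^D)`)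
and the transport of unramified classes along `θ^{±1}` (`Levels.map_mem_unramifiedSubgroup`).
[cite: MilneADT2006, Ch. I, Thm. 2.6] -/
theorem dualTransported_eq_unramifiedSubgroup_of_apply_eq
    (hnondeg : ∀ T, (∀ S, e S T = 1) → T = 0) (hn : IsPrimePow n) (inv : LocalInvariants K n)
    (hperf : inv.IsPerfect) (𝓑 : SelmerStructure (W.torsionGaloisModule n)) (v : HeightOneSpectrum (𝓞 K))
    (hv : ((n : ℕ) : 𝓞 K) ∉ v.asIdeal)
    (h𝓑 : 𝓑 (Sum.inr v) = unramifiedSubgroup (GaloisRep.toLocal v (W.torsionGaloisModule n)) 1) :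
    inv.dualTransported 𝓑 (weilDualIntertwining W n e hμ hadd₁ hadd₂ hgal) (Sum.inr v) =
      unramifiedSubgroup (GaloisRep.toLocal v (W.torsionGaloisModule n)) 1 := by
  have hnM : ∀ m : geomTorsion W n, n • m = 0 := fun m => AddSubgroup.torsionBy.nsmul m
  have hdual := UnramifiedSelfDual.dualLocalCondition_unramifiedSubgroup inv hn hperf
    (W.torsionGaloisModule n) hnM v hv
  ext x
  rw [LocalInvariants.mem_dualTransported_iff, LocalInvariants.dualSelmerStructure_apply, h𝓑, hdual]
  constructor
  · intro hx
    have h := map_mem_unramifiedSubgroup (ρ₁ := GaloisRep.toLocal v ((W.torsionGaloisModule n).tateDual n))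
      (ρ₂ := GaloisRep.toLocal v (W.torsionGaloisModule n))
      ((weilDualInv W n e hμ hadd₁ hadd₂ hgal hnondeg).restrictField (v.adicCompletion K)) hx
    change galoisCohomology.map ((weilDualInv W n e hμ hadd₁ hadd₂ hgal hnondeg).restrictField
        (Place.Completion (Sum.inr v))) 1 (galoisCohomology.map ((weilDualIntertwining W n e hμ hadd₁ hadd₂
          hgal).restrictField (Place.Completion (Sum.inr v))) 1 x) ∈ _ at h
    rwa [map_weilDualInv_map_weilDual_restrictField] at h
  · intro hx
    exact map_mem_unramifiedSubgroup (ρ₁ := GaloisRep.toLocal v (W.torsionGaloisModule n))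
      (ρ₂ := GaloisRep.toLocal v ((W.torsionGaloisModule n).tateDual n))
      ((weilDualIntertwining W n e hμ hadd₁ hadd₂ hgal).restrictField (v.adicCompletion K)) hx

omit [Finite (geomTorsion W n)] in
/-- **`θ⁻¹((0)^*) = ⊤`**: the dual local condition of the zero condition is everything (the pairing of `0`
with anything vanishes). [folklore] -/
theorem dualTransported_eq_top_of_apply_eq_bot (inv : LocalInvariants K n)
    (𝓑 : SelmerStructure (W.torsionGaloisModule n)) (v : HeightOneSpectrum (𝓞 K)) (h𝓑 : 𝓑 (Sum.inr v) = ⊥) :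
    inv.dualTransported 𝓑 (weilDualIntertwining W n e hμ hadd₁ hadd₂ hgal) (Sum.inr v) = ⊤ := by
  ext x
  simp only [LocalInvariants.mem_dualTransported_iff, LocalInvariants.dualSelmerStructure_apply, h𝓑,
    LocalInvariants.mem_dualLocalCondition_iff, AddSubgroup.mem_bot, AddSubgroup.mem_top, iff_true]
  rintro a rfl
  rw [map_zero, AddMonoidHom.zero_apply]

/-! ## §2 The count `#H¹_ℛ = #H¹_𝓢 · ∏_{v ∈ P} #𝓚_v` -/

include hμ hadd₁ hadd₂ hgal in
/-- **Kato's (14.9.3) at finite level: `#H¹_ℛ(K, E[n]) = #H¹_𝓢(K, E[n]) · ∏_{v ∈ P} #𝓚_v`.**  Here `n` is an odd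
prime power, `inv` a Poitou–Tate family (`IsPerfect`, `SumLocalTermEqZero`, `SelmerComplement`), `e` Weil-pairing
data on `E[n]`, `P ⊆ T` finite sets of finite places with `P ⊇ {v ∣ n}` and `T ⊇` the ramification of `E[n]`,
and `𝓢`, `ℛ` ANY Selmer structures on `E[n]` with `𝓢_v = 0`, `ℛ_v = H¹(K_v, E[n])` for `v ∈ P` and
`𝓢_v = ℛ_v = H¹_ur(K_v, E[n])` for every finite `v ∉ P` (bad places included; no condition is imposed at the
infinite places, where `H¹ = 0`); `𝓚_v = W.kummerSelmerStructure n (inr v)` is the local Kummer condition.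
Kato, Astérisque 295: the Selmer groups of `𝓢`/`ℛ` are the level-`n` shadows of `Ker(H²(O_K[1/p],T) → H²_p)^∨`
and `H¹(O_K[1/p], T)` of (14.9.3); the identity is the pair count (`GaloisImage.card_selmerGroup_pair`) for
`𝓢 ≤ 𝓚'` (`𝓚'` = Kummer at `P`, unramified off `P` — Kato's `S(K,T)` at level `n`) with the dual structures
identified through `θ` (§1): `#H¹_{𝓢^*}(E[n]^D) = #H¹_ℛ`, `#H¹_{𝓚'^*}(E[n]^D) = #H¹_{𝓚'}`.
[cite: Kato2004Asterisque, 14.8 (p. 238), (14.9.3) (p. 240), Prop. 14.16 proof (14.16.1)–(14.16.3) (p. 245)]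
[cite: MilneADT2006, Ch. I, Thm. 4.10 and Cor. 3.4] -/
theorem natCard_selmerGroup_relaxed_eq
    (halt : ∀ T, e T T = 1) (hnondeg : ∀ T, (∀ S, e S T = 1) → T = 0) (hn : IsPrimePow n) (hodd : Odd n)
    (inv : LocalInvariants K n) (hperf : inv.IsPerfect) (hsum : inv.SumLocalTermEqZero)
    (hcompl : inv.SelmerComplement)
    (P T : Finset (HeightOneSpectrum (𝓞 K))) (hPT : P ⊆ T)
    (hP : ∀ v : HeightOneSpectrum (𝓞 K), ((n : ℕ) : 𝓞 K) ∈ v.asIdeal → v ∈ P)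
    (hT : ∀ v : HeightOneSpectrum (𝓞 K), v ∉ T → GaloisRep.IsUnramifiedAt v (W.torsionGaloisModule n))
    (𝓢 ℛ : SelmerStructure (W.torsionGaloisModule n))
    (h𝓢P : ∀ v ∈ P, 𝓢 (Sum.inr v) = ⊥) (hℛP : ∀ v ∈ P, ℛ (Sum.inr v) = ⊤)
    (h𝓢ur : ∀ v ∉ P, 𝓢 (Sum.inr v) = unramifiedSubgroup (GaloisRep.toLocal v (W.torsionGaloisModule n)) 1)
    (hℛur : ∀ v ∉ P, ℛ (Sum.inr v) = unramifiedSubgroup (GaloisRep.toLocal v (W.torsionGaloisModule n)) 1) :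
    Nat.card ℛ.selmerGroup =
      Nat.card 𝓢.selmerGroup * ∏ v ∈ P, Nat.card (W.kummerSelmerStructure n (Sum.inr v)) := by
  have hnM : ∀ m : geomTorsion W n, n • m = 0 := fun m => AddSubgroup.torsionBy.nsmul m
  have hnotP : ∀ v : HeightOneSpectrum (𝓞 K), v ∉ P → ((n : ℕ) : 𝓞 K) ∉ v.asIdeal :=
    fun v hv h => hv (hP v h)
  -- Kato's `S(K,T)`-structure at level `n`: Kummer at `P`, unramified off `P`, `𝓢` at the infinite places
  let 𝓚' : SelmerStructure (W.torsionGaloisModule n) := fun v =>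
    match v with
    | Sum.inl w => 𝓢 (Sum.inl w)
    | Sum.inr v => if v ∈ P then W.kummerSelmerStructure n (Sum.inr v) else 𝓢 (Sum.inr v)
  have h𝓚'P : ∀ v ∈ P, 𝓚' (Sum.inr v) = W.kummerSelmerStructure n (Sum.inr v) := fun v hv => by
    change (if v ∈ P then _ else _) = _; rw [if_pos hv]
  have h𝓚'nP : ∀ v ∉ P, 𝓚' (Sum.inr v) = 𝓢 (Sum.inr v) := fun v hv => by
    change (if v ∈ P then _ else _) = _; rw [if_neg hv]
  have hle : 𝓢 ≤ 𝓚' := by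
    intro v
    rcases v with w | v
    · exact le_rfl
    · by_cases hv : v ∈ P
      · rw [h𝓢P v hv]; exact bot_le
      · rw [h𝓚'nP v hv]
  -- unramified outside `S(T)`
  have h𝓢T : 𝓢.IsUnramifiedOutside (finSupport T) :=
    ⟨fun w => inl_mem_finSupport T w, fun v hv =>
      h𝓢ur v (fun h => hv ((inr_mem_finSupport_iff T v).2 (hPT h)))⟩
  have h𝓚'T : 𝓚'.IsUnramifiedOutside (finSupport T) :=
    ⟨fun w => inl_mem_finSupport T w, fun v hv => by
      have hvP : v ∉ P := fun h => hv ((inr_mem_finSupport_iff T v).2 (hPT h))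
      rw [h𝓚'nP v hvP, h𝓢ur v hvP]⟩
  have hS : ∀ v : HeightOneSpectrum (𝓞 K), v ∉ T →
      ((n : ℕ) : 𝓞 K) ∉ v.asIdeal ∧ GaloisRep.IsUnramifiedAt v (W.torsionGaloisModule n) :=
    fun v hv => ⟨hnotP v (fun h => hv (hPT h)), hT v hv⟩
  -- the pair count for `𝓢 ≤ 𝓚'`
  have hpair := card_selmerGroup_pair (W.torsionGaloisModule n) T inv hperf hsum hcompl hnM hS hle h𝓢T h𝓚'T
    (fun w => rfl)
  -- finiteness of the Selmer groups involved
  haveI : Finite ℛ.selmerGroup :=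
    SelmerFinite.finite_selmerGroup_of_unramified_outside (W.torsionGaloisModule n) (S := (↑T : Set _))
      T.finite_toSet (fun v hv => hT v hv) fun v hv => hℛur v (fun h => hv (hPT h))
  haveI : Finite 𝓚'.selmerGroup :=
    SelmerFinite.finite_selmerGroup_of_isUnramifiedOutside (W.torsionGaloisModule n)
      (fun v hv => hT v (fun h => hv ((inr_mem_finSupport_iff T v).2 h))) h𝓚'T
  -- the two dual Selmer groups, through `θ`
  have hEP : ∀ v : HeightOneSpectrum (𝓞 K), localEulerPoincareCharacteristic (v.adicCompletion K) :=
    fun v => by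
      haveI : CharZero (v.adicCompletion K) := charZero_adicCompletion v
      exact localEulerPoincareCharacteristic_holds (v.adicCompletion K)
  have hinv : ∀ v : HeightOneSpectrum (𝓞 K), Injective (inv (Sum.inr v)) := fun v => (hperf v).1.1
  have hdual𝓢 : Nat.card ℛ.selmerGroup =
      Nat.card (inv.dualSelmerStructure (W.torsionGaloisModule n) 𝓢).selmerGroup := by
    refine natCard_selmerGroup_eq_natCard_dualSelmerGroup_of_dualTransported W n e hμ hadd₁ hadd₂ hgal hnondeg
      hodd inv ℛ 𝓢 fun v => ?_
    by_cases hv : v ∈ P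
    · rw [hℛP v hv]
      exact dualTransported_eq_top_of_apply_eq_bot W n e hμ hadd₁ hadd₂ hgal inv 𝓢 v (h𝓢P v hv)
    · rw [hℛur v hv]
      exact dualTransported_eq_unramifiedSubgroup_of_apply_eq W n e hμ hadd₁ hadd₂ hgal hnondeg hn inv hperf 𝓢 v
        (hnotP v hv) (h𝓢ur v hv)
  have hdual𝓚' : Nat.card 𝓚'.selmerGroup =
      Nat.card (inv.dualSelmerStructure (W.torsionGaloisModule n) 𝓚').selmerGroup := by
    refine natCard_selmerGroup_eq_natCard_dualSelmerGroup_of_dualTransported W n e hμ hadd₁ hadd₂ hgal hnondeg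
      hodd inv 𝓚' 𝓚' fun v => ?_
    by_cases hv : v ∈ P
    · -- Tate local duality for `E`: `θ⁻¹(𝓚_v^*) = 𝓚_v` (n1011)
      have h := dualTransported_kummerSelmerStructure_inr W n e hμ hadd₁ hadd₂ hgal halt hnondeg hn v (hEP v)
        inv (hinv v)
      rw [h𝓚'P v hv, ← h]
      ext x
      simp only [LocalInvariants.mem_dualTransported_iff, LocalInvariants.dualSelmerStructure_apply, h𝓚'P v hv]
    · rw [h𝓚'nP v hv, h𝓢ur v hv]
      exact dualTransported_eq_unramifiedSubgroup_of_apply_eq W n e hμ hadd₁ hadd₂ hgal hnondeg hn inv hperf 𝓚' v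
        (hnotP v hv) ((h𝓚'nP v hv).trans (h𝓢ur v hv))
  -- the local products over `T = P ⊔ (T \ P)`
  have hprod𝓢 : ∏ v ∈ T, Nat.card (𝓢 (Sum.inr v)) = ∏ v ∈ T \ P, Nat.card (𝓢 (Sum.inr v)) := by
    rw [← Finset.prod_sdiff hPT]
    have h1 : ∏ v ∈ P, Nat.card (𝓢 (Sum.inr v)) = 1 :=
      Finset.prod_eq_one fun v hv => by rw [h𝓢P v hv]; exact Nat.card_unique
    rw [h1, mul_one]
  have hprod𝓚' : ∏ v ∈ T, Nat.card (𝓚' (Sum.inr v)) =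
      (∏ v ∈ T \ P, Nat.card (𝓢 (Sum.inr v))) * ∏ v ∈ P, Nat.card (W.kummerSelmerStructure n (Sum.inr v)) := by
    rw [← Finset.prod_sdiff hPT]
    congr 1
    · exact Finset.prod_congr rfl fun v hv => by rw [h𝓚'nP v (Finset.mem_sdiff.1 hv).2]
    · exact Finset.prod_congr rfl fun v hv => by rw [h𝓚'P v hv]
  rw [hprod𝓢, hprod𝓚', ← hdual𝓢, ← hdual𝓚'] at hpair
  -- cancel the positive factor `#H¹_{𝓚'} · ∏_{T \ P} #𝓢_v`
  have hpos : 0 < Nat.card 𝓚'.selmerGroup * ∏ v ∈ T \ P, Nat.card (𝓢 (Sum.inr v)) := by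
    refine Nat.mul_pos Nat.card_pos (Finset.prod_pos fun v _ => ?_)
    haveI : CharZero (v.adicCompletion K) := charZero_adicCompletion v
    haveI : Finite (galoisCohomology ((W.torsionGaloisModule n).toLocal (Sum.inr v)) 1) :=
      finite_galoisCohomology_one_of_isNonarchimedeanLocalField (GaloisRep.toLocal v (W.torsionGaloisModule n))
    haveI : Finite (𝓢 (Sum.inr v)) := inferInstance
    exact Nat.card_pos
  refine Nat.eq_of_mul_eq_mul_left hpos ?_
  calc Nat.card 𝓚'.selmerGroup * (∏ v ∈ T \ P, Nat.card (𝓢 (Sum.inr v))) * Nat.card ℛ.selmerGroup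
      = Nat.card 𝓚'.selmerGroup * Nat.card ℛ.selmerGroup * ∏ v ∈ T \ P, Nat.card (𝓢 (Sum.inr v)) := by ring
    _ = Nat.card 𝓢.selmerGroup * Nat.card 𝓚'.selmerGroup *
          ((∏ v ∈ T \ P, Nat.card (𝓢 (Sum.inr v))) *
            ∏ v ∈ P, Nat.card (W.kummerSelmerStructure n (Sum.inr v))) := hpair
    _ = Nat.card 𝓚'.selmerGroup * (∏ v ∈ T \ P, Nat.card (𝓢 (Sum.inr v))) *
          (Nat.card 𝓢.selmerGroup * ∏ v ∈ P, Nat.card (W.kummerSelmerStructure n (Sum.inr v))) := by ring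

end Summit.BirchSwinnertonDyer.BirchSwinnertonDyer.Theorems.KatoFiniteLevelCount

end
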